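import Summits.HodgeConjecture.HodgeConjecture.Theses.TropicalWeilObstruction
import Summits.HodgeConjecture.HodgeConjecture.Theorems.TropicalWeilObstructionTropicalHodgeBoundFramePairing
import HarnessLib

/-!
# Crux `TropicalHodgeBound` (route `TropicalWeilObstruction`), line `birth`: the `dz ⊗ dz` pairing in
# general dimension and the registered stub `stub_weilFunctional_eq_pairing` (`W = Ŵ ∘ cyc`)

Registered skeleton `Cruxes/TropicalHodgeBound/Lines/birth.lean` (crux item stmt-HodgeConjecture-18480,
`Summit.HodgeConjecture.HodgeConjecture.Theses.TropicalWeilObstruction.TropicalHodgeBound`). Its local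
definitions `dzCoord`, `weilPairing` (`Ŵ`), `thetaClass` (`θ_n(Q)`), `omegaFrame` (`Ω`), `weilClassC/Re/Im`
(`w(Q)`, `w₁ = Re w`, `w₂ = Im w`) and the stub statement `WeilFunctionalEqPairing` are rendered here by
file-local `notation3` with the skeleton's bodies verbatim (display only; nothing is defined), so that
`stub_weilFunctional_eq_pairing` below carries the REGISTERED signature and is definitionally the skeleton's
statement (bridge inside the skeleton: `intro Q Z; simp only [weilPairing, dzCoord, LinearMap.coe_mk,
AddHom.coe_mk]; exact stub_weilFunctional_eq_pairing Q Z`). The sibling files `…WeilPairingThetaClass`,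
`…WeilPairingWeilClasses` land stubs 2 and 3 from the general-`n` identities proved here.

Proofs (all for a general half-dimension `n`, then `n = 4`), with `P = [1 | i·1]` the matrix of `dz`
(`dzCoord n S = det P[·,S]`) and the all-maps Cauchy–Binet formula of the helper file
`TropicalWeilObstructionTropicalHodgeBoundFramePairing`:
* stub 1 `W = Ŵ ∘ cyc`: `Σ_S dz(S) · det L[S,·] = n! · det (P L) = n! · η(L)` cell by cell
  (`weilFunctional_eq_weilPairing_cyc`);
* stub 2 `Ŵ(θ_n(Q)) = det (P Q Pᵀ) = 0` for `QJ = JQ` (`weilPairing_thetaClass_eq_det`);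
* stub 3: `Ŵ(w₁) + iŴ(w₂) = Ŵ_ℂ(w) = det (P Q Pᴴ) · det (P Pᴴ) = 2ⁿ det (P Q Pᴴ) ≠ 0` for `Q ≻ 0` and
  `Ŵ(w₁) - iŴ(w₂) = Ŵ_ℂ(w̄) = det (P Q Pᵀ) · det (P Pᵀ) = 0`, so `Ŵ(w₁) = iŴ(w₂) ≠ 0` and a rational
  relation `sŴ(w₁) + tŴ(w₂) = 0` forces `s = t = 0` (`weilPairing_weilClasses_indep`; the hypothesis
  `QJ = JQ` of the registered statement is not needed for this step).
HONEST STATUS. Linear algebra of the `dz ⊗ dz` pairing only; the load-bearing stub 4 of the line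
(Mikhalkin–Zharkov Prop. 4.3 / Thm. 5.4 + the generic rank-3 certificate) is NOT touched, and nothing
here bears on the Hodge conjecture itself. No definition, no named fact, no sorry.
References: [cite: Zharkov2020TropicalWeil, §2] [cite: MikhalkinZharkov2014Eigenwave, Prop. 4.3 and Thm. 5.4].
-/

set_option linter.dupNamespace false

noncomputable section

open scoped BigOperators
open Matrix
open Literature.AlgebraicGeometry.Tropical

namespace Summit.HodgeConjecture.HodgeConjecture.Theorems.TropicalHodgeBound

/-! ## §0 Display-only notation (the skeleton's local definitions, verbatim bodies) -/

/-- `P = [1 | i·1]`, the `n × 2n` matrix of `dz₁ ∧ … ∧ dz_n` (as in the helper file). -/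
local notation3 (prettyPrint := false) "𝐏⟦" n "⟧" =>
  (Matrix.of fun (k : Fin n) (a : Fin (2 * n)) =>
    (if (a : ℕ) = (k : ℕ) then (1 : ℂ) else 0) + (if (a : ℕ) = (k : ℕ) + n then Complex.I else 0))

/-- The skeleton's `dzCoord n S`. -/
local notation3 (prettyPrint := false) "dz⟦" n "⟧" S:max =>
  (Matrix.det (Matrix.of fun k a : Fin n =>
    (if (S a : ℕ) = (k : ℕ) then (1 : ℂ) else 0) + (if (S a : ℕ) = (k : ℕ) + n then Complex.I else 0)))

/-- The skeleton's `weilPairing n C` (the value `Ŵ(C)`). -/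
local notation3 (prettyPrint := false) "Ŵ⟦" n "⟧" C:max =>
  (∑ S : Fin n → Fin (2 * n), ∑ S' : Fin n → Fin (2 * n),
    dz⟦n⟧ S * dz⟦n⟧ S' / ((Nat.factorial n : ℂ) ^ 2) * ((C S S' : ℝ) : ℂ))

/-- The skeleton's `thetaClass n Q`. -/
local notation3 (prettyPrint := false) "θ⟦" n "⟧" Q:max =>
  (fun S S' : Fin n → Fin (2 * n) => Matrix.det (Matrix.submatrix Q S S'))

/-- The skeleton's `omegaFrame n` (`Ω`, the frame `ω_b = e_b - i e_{b+n}`). -/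
local notation3 (prettyPrint := false) "Ω⟦" n "⟧" =>
  (Matrix.of fun (a : Fin (2 * n)) (b : Fin n) =>
    (if (a : ℕ) = (b : ℕ) then (1 : ℂ) else 0) - (if (a : ℕ) = (b : ℕ) + n then Complex.I else 0))

/-- The skeleton's `weilClassC n Q` (`w(Q) = (⋀ⁿQ ⊗ 1)(Ω ⊗ Ω)`). -/
local notation3 (prettyPrint := false) "wC⟦" n "⟧" Q:max =>
  (fun S S' : Fin n → Fin (2 * n) =>
    Matrix.det (Matrix.submatrix (Matrix.map Q ((↑) : ℝ → ℂ) * Ω⟦n⟧) S id) *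
      Matrix.det (Matrix.submatrix (Ω⟦n⟧) S' id))

/-- The skeleton's `weilClassRe n Q` (`w₁ = Re w`). -/
local notation3 (prettyPrint := false) "wRe⟦" n "⟧" Q:max =>
  (fun S S' : Fin n → Fin (2 * n) => Complex.re ((wC⟦n⟧ Q) S S'))

/-- The skeleton's `weilClassIm n Q` (`w₂ = Im w`). -/
local notation3 (prettyPrint := false) "wIm⟦" n "⟧" Q:max =>
  (fun S S' : Fin n → Fin (2 * n) => Complex.im ((wC⟦n⟧ Q) S S'))

/-- The skeleton's `WeilFunctionalEqPairing` (stub 1 statement). -/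
local notation3 (prettyPrint := false) "WeilFunctionalEqPairing" =>
  (∀ (Q : Matrix (Fin (2 * 4)) (Fin (2 * 4)) ℝ) (Z : TropicalTorusCycle (2 * 4) 4 Q),
    weilFunctional Z = Ŵ⟦4⟧ (TropicalTorusCycle.cyc Z))

/-! ## §1 Casting determinants, `dz = det P[·,S]`, `η = det (P L)` -/

section General

variable {n : ℕ}

/-- `dzCoord n S = det P[·, S]`. [folklore] -/
theorem dz_eq_det_submatrix (S : Fin n → Fin (2 * n)) :
    dz⟦n⟧ S = ((𝐏⟦n⟧).submatrix id S).det := rfl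

/-- `ℝ → ℂ` commutes with `det`. [folklore] -/
theorem ofReal_det {m : Type*} [Fintype m] [DecidableEq m] (M : Matrix m m ℝ) :
    ((M.det : ℝ) : ℂ) = (M.map ((↑) : ℝ → ℂ)).det :=
  RingHom.map_det Complex.ofRealHom M

/-- `ℤ → ℂ` commutes with `det`. [folklore] -/
theorem intCast_det {m : Type*} [Fintype m] [DecidableEq m] (M : Matrix m m ℤ) :
    ((M.det : ℤ) : ℂ) = (M.map ((↑) : ℤ → ℂ)).det := by
  simpa using RingHom.map_det (Int.castRingHom ℂ) M

/-- `η(L) = frameComplexDet n L = det (P L)`. [cite: Zharkov2020TropicalWeil, §2] -/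
theorem frameComplexDet_eq_det (L : Matrix (Fin (2 * n)) (Fin n) ℤ) :
    frameComplexDet n L = (𝐏⟦n⟧ * L.map ((↑) : ℤ → ℂ)).det := by
  unfold frameComplexDet
  congr 1
  ext k j
  rw [frame_mul_apply]
  simp only [Matrix.of_apply, Matrix.map_apply]
  ring

/-- Cauchy–Binet for one cell: `Σ_S dz(S) · det L[S,·] = n! · η(L)`. [cite: MikhalkinZharkov2014Eigenwave, Prop. 4.3] -/
theorem sum_dz_mul_pluckerCoord (L : Matrix (Fin (2 * n)) (Fin n) ℤ) :
    ∑ S : Fin n → Fin (2 * n), dz⟦n⟧ S * ((pluckerCoord L S : ℤ) : ℂ) =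
      (Nat.factorial n : ℂ) * frameComplexDet n L := by
  rw [frameComplexDet_eq_det, ← sum_det_submatrix_mul_det_submatrix]
  refine Finset.sum_congr rfl fun S _ => ?_
  rw [dz_eq_det_submatrix, pluckerCoord, intCast_det, Matrix.submatrix_map]

/-! ## §2 Stub 1 in general dimension: `W = Ŵ ∘ cyc` -/

/-- **`W(Z) = Ŵ([Z])`** for every effective tropical `n`-cycle `Z` on `ℝ²ⁿ/Q·ℤ²ⁿ`: both sides are
`Σ_σ w_σ a_σ η_σ²`, by `Σ_S dz(S) det L_σ[S,·] = n! η_σ` in each factor.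
[cite: MikhalkinZharkov2014Eigenwave, Prop. 4.3] [cite: Zharkov2020TropicalWeil, §2] -/
theorem weilFunctional_eq_weilPairing_cyc (Q : Matrix (Fin (2 * n)) (Fin (2 * n)) ℝ)
    (Z : TropicalTorusCycle (2 * n) n Q) :
    weilFunctional Z = Ŵ⟦n⟧ (TropicalTorusCycle.cyc Z) := by
  have hF : (Nat.factorial n : ℂ) ≠ 0 := by exact_mod_cast Nat.factorial_ne_zero n
  unfold weilFunctional TropicalTorusCycle.cyc
  symm
  calc ∑ S : Fin n → Fin (2 * n), ∑ S' : Fin n → Fin (2 * n),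
        dz⟦n⟧ S * dz⟦n⟧ S' / ((Nat.factorial n : ℂ) ^ 2) *
          (((fun S S' : Fin n → Fin (2 * n) => ∑ σ, ((Z.cell σ).weight : ℝ) * (Z.cell σ).latticeVolume *
            ((pluckerCoord (Z.cell σ).frame S : ℤ) : ℝ) *
            ((pluckerCoord (Z.cell σ).frame S' : ℤ) : ℝ)) S S' : ℝ) : ℂ)
      = ∑ S : Fin n → Fin (2 * n), ∑ S' : Fin n → Fin (2 * n), ∑ σ,
          dz⟦n⟧ S * dz⟦n⟧ S' / ((Nat.factorial n : ℂ) ^ 2) *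
            (((Z.cell σ).weight : ℂ) * ((Z.cell σ).latticeVolume : ℂ) *
              ((pluckerCoord (Z.cell σ).frame S : ℤ) : ℂ) * ((pluckerCoord (Z.cell σ).frame S' : ℤ) : ℂ)) := by
        refine Finset.sum_congr rfl fun S _ => Finset.sum_congr rfl fun S' _ => ?_
        beta_reduce
        rw [Complex.ofReal_sum, Finset.mul_sum]
        refine Finset.sum_congr rfl fun σ _ => ?_
        push_cast
        ring
    _ = ∑ σ, ∑ S : Fin n → Fin (2 * n), ∑ S' : Fin n → Fin (2 * n),
          dz⟦n⟧ S * dz⟦n⟧ S' / ((Nat.factorial n : ℂ) ^ 2) *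
            (((Z.cell σ).weight : ℂ) * ((Z.cell σ).latticeVolume : ℂ) *
              ((pluckerCoord (Z.cell σ).frame S : ℤ) : ℂ) * ((pluckerCoord (Z.cell σ).frame S' : ℤ) : ℂ)) := by
        conv_lhs => enter [2, S]; rw [Finset.sum_comm]
        rw [Finset.sum_comm]
    _ = ∑ σ, ((Z.cell σ).weight : ℂ) * ((Z.cell σ).latticeVolume : ℂ) *
          frameComplexDet n (Z.cell σ).frame ^ 2 := by
        refine Finset.sum_congr rfl fun σ _ => ?_
        have key : ∑ S : Fin n → Fin (2 * n), ∑ S' : Fin n → Fin (2 * n),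
            dz⟦n⟧ S * dz⟦n⟧ S' / ((Nat.factorial n : ℂ) ^ 2) *
              (((Z.cell σ).weight : ℂ) * ((Z.cell σ).latticeVolume : ℂ) *
                ((pluckerCoord (Z.cell σ).frame S : ℤ) : ℂ) *
                ((pluckerCoord (Z.cell σ).frame S' : ℤ) : ℂ)) =
            ((Z.cell σ).weight : ℂ) * ((Z.cell σ).latticeVolume : ℂ) / ((Nat.factorial n : ℂ) ^ 2) *
              ((∑ S : Fin n → Fin (2 * n), dz⟦n⟧ S * ((pluckerCoord (Z.cell σ).frame S : ℤ) : ℂ)) *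
               (∑ S' : Fin n → Fin (2 * n), dz⟦n⟧ S' * ((pluckerCoord (Z.cell σ).frame S' : ℤ) : ℂ))) := by
          rw [Finset.sum_mul_sum, Finset.mul_sum]
          refine Finset.sum_congr rfl fun S _ => ?_
          rw [Finset.mul_sum]
          refine Finset.sum_congr rfl fun S' _ => ?_
          ring
        rw [key, sum_dz_mul_pluckerCoord]
        field_simp

/-! ## §3 Stub 2 in general dimension: `Ŵ(θ_n(Q)) = det (P Q Pᵀ)` -/

/-- **`Ŵ(θ_n(Q)) = det (P Q Pᵀ)`** (all-maps Cauchy–Binet twice). [cite: Zharkov2020TropicalWeil, §2] -/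
theorem weilPairing_thetaClass_eq_det (Q : Matrix (Fin (2 * n)) (Fin (2 * n)) ℝ) :
    Ŵ⟦n⟧ (θ⟦n⟧ Q) = (𝐏⟦n⟧ * Q.map ((↑) : ℝ → ℂ) * (𝐏⟦n⟧)ᵀ).det := by
  have hF : (Nat.factorial n : ℂ) ≠ 0 := by exact_mod_cast Nat.factorial_ne_zero n
  calc Ŵ⟦n⟧ (θ⟦n⟧ Q)
      = (∑ S : Fin n → Fin (2 * n), ∑ S' : Fin n → Fin (2 * n),
          ((𝐏⟦n⟧).submatrix id S).det * ((𝐏⟦n⟧).submatrix id S').det *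
            ((Q.map ((↑) : ℝ → ℂ)).submatrix S S').det) / ((Nat.factorial n : ℂ) ^ 2) := by
        rw [Finset.sum_div]
        refine Finset.sum_congr rfl fun S _ => ?_
        rw [Finset.sum_div]
        refine Finset.sum_congr rfl fun S' _ => ?_
        beta_reduce
        rw [dz_eq_det_submatrix, dz_eq_det_submatrix, ofReal_det, ← Matrix.submatrix_map]
        ring
    _ = (𝐏⟦n⟧ * Q.map ((↑) : ℝ → ℂ) * (𝐏⟦n⟧)ᵀ).det := by
        rw [sum_sum_det_mul_det_mul_det_submatrix, mul_div_cancel_left₀ _ (pow_ne_zero 2 hF)]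

/-- **`Ŵ(θ_n(Q)) = 0` for `QJ = JQ`, `n ≥ 1`.** [cite: Zharkov2020TropicalWeil, §2] -/
theorem weilPairing_thetaClass_eq_zero (hn : 0 < n) (Q : Matrix (Fin (2 * n)) (Fin (2 * n)) ℝ)
    (hJ : Q * weilJ n = weilJ n * Q) : Ŵ⟦n⟧ (θ⟦n⟧ Q) = 0 := by
  haveI : Nonempty (Fin n) := ⟨⟨0, hn⟩⟩
  rw [weilPairing_thetaClass_eq_det, frame_mul_map_mul_frame_transpose_eq_zero Q hJ, Matrix.det_zero]

/-! ## §4 Stub 3 in general dimension: `Ŵ(w₁) = iŴ(w₂) = 2ⁿ⁻¹ det (P Q Pᴴ) ≠ 0` -/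

/-- `Re`/`Im` recombine under a complex-linear functional: `Ŵ(Re w) + iŴ(Im w) = Ŵ_ℂ(w)`. [folklore] -/
theorem sum_sum_mul_re_add_I_mul {α : Type*} [Fintype α] (c w : α → α → ℂ) :
    (∑ S, ∑ S', c S S' * (((w S S').re : ℝ) : ℂ)) +
        Complex.I * ∑ S, ∑ S', c S S' * (((w S S').im : ℝ) : ℂ) =
      ∑ S, ∑ S', c S S' * w S S' := by
  rw [Finset.mul_sum, ← Finset.sum_add_distrib]
  refine Finset.sum_congr rfl fun S _ => ?_
  rw [Finset.mul_sum, ← Finset.sum_add_distrib]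
  refine Finset.sum_congr rfl fun S' _ => ?_
  conv_rhs => rw [← Complex.re_add_im (w S S')]
  ring

/-- `Ŵ(Re w) - iŴ(Im w) = Ŵ_ℂ(w̄)`. [folklore] -/
theorem sum_sum_mul_re_sub_I_mul {α : Type*} [Fintype α] (c w : α → α → ℂ) :
    (∑ S, ∑ S', c S S' * (((w S S').re : ℝ) : ℂ)) -
        Complex.I * ∑ S, ∑ S', c S S' * (((w S S').im : ℝ) : ℂ) =
      ∑ S, ∑ S', c S S' * (starRingEnd ℂ) (w S S') := by
  rw [Finset.mul_sum, ← Finset.sum_sub_distrib]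
  refine Finset.sum_congr rfl fun S _ => ?_
  rw [Finset.mul_sum, ← Finset.sum_sub_distrib]
  refine Finset.sum_congr rfl fun S' _ => ?_
  have h : (starRingEnd ℂ) (w S S') = (((w S S').re : ℝ) : ℂ) - (((w S S').im : ℝ) : ℂ) * Complex.I := by
    apply Complex.ext <;> simp
  rw [h]
  ring

/-- A real matrix is fixed by complex conjugation. [folklore] -/
theorem map_ofReal_map_conj {l m : Type*} (Q : Matrix l m ℝ) :
    (Q.map ((↑) : ℝ → ℂ)).map (starRingEnd ℂ) = Q.map ((↑) : ℝ → ℂ) := by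
  ext a b
  simp only [Matrix.map_apply, Complex.conj_ofReal]

/-- **`Ŵ_ℂ(w(Q)) = det (P Q Pᴴ) · 2ⁿ`** (`Ω = Pᴴ`, Cauchy–Binet in each factor, `det (P Pᴴ) = 2ⁿ`).
[cite: Zharkov2020TropicalWeil, §2] -/
theorem weilPairingC_weilClassC_eq (Q : Matrix (Fin (2 * n)) (Fin (2 * n)) ℝ) :
    ∑ S : Fin n → Fin (2 * n), ∑ S' : Fin n → Fin (2 * n),
        dz⟦n⟧ S * dz⟦n⟧ S' / ((Nat.factorial n : ℂ) ^ 2) * ((wC⟦n⟧ Q) S S') =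
      (𝐏⟦n⟧ * Q.map ((↑) : ℝ → ℂ) * (𝐏⟦n⟧)ᴴ).det * (2 : ℂ) ^ n := by
  have hF : (Nat.factorial n : ℂ) ≠ 0 := by exact_mod_cast Nat.factorial_ne_zero n
  beta_reduce
  simp only [← frame_conjTranspose_eq, dz_eq_det_submatrix]
  calc ∑ S : Fin n → Fin (2 * n), ∑ S' : Fin n → Fin (2 * n),
        ((𝐏⟦n⟧).submatrix id S).det * ((𝐏⟦n⟧).submatrix id S').det / ((Nat.factorial n : ℂ) ^ 2) *
          (((Q.map ((↑) : ℝ → ℂ) * (𝐏⟦n⟧)ᴴ).submatrix S id).det * (((𝐏⟦n⟧)ᴴ).submatrix S' id).det)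
      = (∑ S : Fin n → Fin (2 * n), ∑ S' : Fin n → Fin (2 * n),
          ((𝐏⟦n⟧).submatrix id S).det * ((𝐏⟦n⟧).submatrix id S').det *
          (((Q.map ((↑) : ℝ → ℂ) * (𝐏⟦n⟧)ᴴ).submatrix S id).det * (((𝐏⟦n⟧)ᴴ).submatrix S' id).det)) /
          ((Nat.factorial n : ℂ) ^ 2) := by
        rw [Finset.sum_div]
        refine Finset.sum_congr rfl fun S _ => ?_
        rw [Finset.sum_div]
        refine Finset.sum_congr rfl fun S' _ => ?_
        ring
    _ = (𝐏⟦n⟧ * Q.map ((↑) : ℝ → ℂ) * (𝐏⟦n⟧)ᴴ).det * (2 : ℂ) ^ n := by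
        rw [sum_sum_det_mul_det_mul_det_mul_det, ← Matrix.mul_assoc, det_frame_mul_frame_conjTranspose]
        field_simp

/-- **`Ŵ_ℂ(w̄(Q)) = det (P Q Pᵀ) · det (P Pᵀ) = 0`** (`Ω̄ = Pᵀ`, `P Pᵀ = 0`), `n ≥ 1`.
[cite: Zharkov2020TropicalWeil, §2] -/
theorem weilPairingC_conj_weilClassC_eq_zero (hn : 0 < n) (Q : Matrix (Fin (2 * n)) (Fin (2 * n)) ℝ) :
    ∑ S : Fin n → Fin (2 * n), ∑ S' : Fin n → Fin (2 * n),
        dz⟦n⟧ S * dz⟦n⟧ S' / ((Nat.factorial n : ℂ) ^ 2) * (starRingEnd ℂ) ((wC⟦n⟧ Q) S S') = 0 := by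
  haveI : Nonempty (Fin n) := ⟨⟨0, hn⟩⟩
  beta_reduce
  simp only [← frame_conjTranspose_eq, dz_eq_det_submatrix, map_mul, RingHom.map_det,
    RingHom.mapMatrix_apply, ← Matrix.submatrix_map, Matrix.map_mul, map_ofReal_map_conj,
    frame_conjTranspose_map_conj]
  calc ∑ S : Fin n → Fin (2 * n), ∑ S' : Fin n → Fin (2 * n),
        ((𝐏⟦n⟧).submatrix id S).det * ((𝐏⟦n⟧).submatrix id S').det / ((Nat.factorial n : ℂ) ^ 2) *
          (((Q.map ((↑) : ℝ → ℂ) * (𝐏⟦n⟧)ᵀ).submatrix S id).det * (((𝐏⟦n⟧)ᵀ).submatrix S' id).det)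
      = (∑ S : Fin n → Fin (2 * n), ∑ S' : Fin n → Fin (2 * n),
          ((𝐏⟦n⟧).submatrix id S).det * ((𝐏⟦n⟧).submatrix id S').det *
          (((Q.map ((↑) : ℝ → ℂ) * (𝐏⟦n⟧)ᵀ).submatrix S id).det * (((𝐏⟦n⟧)ᵀ).submatrix S' id).det)) /
          ((Nat.factorial n : ℂ) ^ 2) := by
        rw [Finset.sum_div]
        refine Finset.sum_congr rfl fun S _ => ?_
        rw [Finset.sum_div]
        refine Finset.sum_congr rfl fun S' _ => ?_
        ring
    _ = 0 := by
        rw [sum_sum_det_mul_det_mul_det_mul_det, frame_mul_frame_transpose, Matrix.det_zero]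
        simp

/-- **Stub 3 in general dimension `n ≥ 1`.** For `Q ≻ 0` the values `Ŵ(w₁(Q))`, `Ŵ(w₂(Q))` are
`ℚ`-linearly independent: `Ŵ(w₁) + iŴ(w₂) = 2ⁿ det (P Q Pᴴ) ≠ 0` and `Ŵ(w₁) - iŴ(w₂) = 0`.
[cite: Zharkov2020TropicalWeil, §2] -/
theorem weilPairing_weilClasses_indep (hn : 0 < n) (Q : Matrix (Fin (2 * n)) (Fin (2 * n)) ℝ)
    (hQ : Q.PosDef) (s t : ℚ)
    (h : (s : ℂ) * Ŵ⟦n⟧ (wRe⟦n⟧ Q) + (t : ℂ) * Ŵ⟦n⟧ (wIm⟦n⟧ Q) = 0) : s = 0 ∧ t = 0 := by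
  beta_reduce at h
  have hA := sum_sum_mul_re_add_I_mul
    (fun S S' : Fin n → Fin (2 * n) => dz⟦n⟧ S * dz⟦n⟧ S' / ((Nat.factorial n : ℂ) ^ 2)) (wC⟦n⟧ Q)
  have hB := sum_sum_mul_re_sub_I_mul
    (fun S S' : Fin n → Fin (2 * n) => dz⟦n⟧ S * dz⟦n⟧ S' / ((Nat.factorial n : ℂ) ^ 2)) (wC⟦n⟧ Q)
  beta_reduce at hA hB
  rw [weilPairingC_weilClassC_eq Q] at hA
  rw [weilPairingC_conj_weilClassC_eq_zero hn Q] at hB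
  have hWc : (𝐏⟦n⟧ * Q.map ((↑) : ℝ → ℂ) * (𝐏⟦n⟧)ᴴ).det * (2 : ℂ) ^ n ≠ 0 :=
    mul_ne_zero (det_frame_mul_map_mul_conjTranspose_ne_zero Q hQ) (pow_ne_zero n two_ne_zero)
  -- abbreviate `X = Ŵ(w₁)`, `Y = Ŵ(w₂)`
  set X := ∑ S : Fin n → Fin (2 * n), ∑ S' : Fin n → Fin (2 * n),
    dz⟦n⟧ S * dz⟦n⟧ S' / ((Nat.factorial n : ℂ) ^ 2) *
      (((Matrix.det (Matrix.submatrix (Matrix.map Q ((↑) : ℝ → ℂ) * Ω⟦n⟧) S id) *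
        Matrix.det (Matrix.submatrix (Ω⟦n⟧) S' id)).re : ℝ) : ℂ) with hXdef
  set Y := ∑ S : Fin n → Fin (2 * n), ∑ S' : Fin n → Fin (2 * n),
    dz⟦n⟧ S * dz⟦n⟧ S' / ((Nat.factorial n : ℂ) ^ 2) *
      (((Matrix.det (Matrix.submatrix (Matrix.map Q ((↑) : ℝ → ℂ) * Ω⟦n⟧) S id) *
        Matrix.det (Matrix.submatrix (Ω⟦n⟧) S' id)).im : ℝ) : ℂ) with hYdef
  have hX : X = Complex.I * Y := by linear_combination hB
  have hY : Y ≠ 0 := by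
    intro hY0
    apply hWc
    rw [← hA, hX, hY0]
    simp
  have hst : ((t : ℂ) + (s : ℂ) * Complex.I) * Y = 0 := by
    rw [hX] at h
    linear_combination h
  have hst' : (t : ℂ) + (s : ℂ) * Complex.I = 0 := (mul_eq_zero.mp hst).resolve_right hY
  have hre := congrArg Complex.re hst'
  have him := congrArg Complex.im hst'
  simp only [Complex.add_re, Complex.ratCast_re, Complex.mul_re, Complex.I_re, mul_zero,
    Complex.ratCast_im, Complex.I_im, mul_one, sub_self, add_zero, Complex.zero_re, Complex.add_im,
    Complex.mul_im, zero_add, Complex.zero_im] at hre him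
  exact ⟨by exact_mod_cast him, by exact_mod_cast hre⟩

end General

/-! ## §5 The registered stub 1 (`n = 4`) -/

/-- **Stub 1 (registered): `W = Ŵ ∘ cyc`.** [cite: MikhalkinZharkov2014Eigenwave, Prop. 4.3]
[cite: Zharkov2020TropicalWeil, §2] -/
theorem stub_weilFunctional_eq_pairing : WeilFunctionalEqPairing :=
  fun Q Z => weilFunctional_eq_weilPairing_cyc Q Z

end Summit.HodgeConjecture.HodgeConjecture.Theorems.TropicalHodgeBound

end
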